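import Summits.QuantumFields.YangMills.Theorems.UnitScaleTiltProp7OneFormConjugateResolvent
import Summits.QuantumFields.YangMills.Theorems.UnitScaleTiltProp7OneFormAgmon
import HarnessLib

/-!
# Route `UnitScaleTilt`, crux K1 «MinimiserStabilityRegPr» (stmt-QuantumFields-19200), EX rows `h137kπ` ∕ `h137kΔ` ∕ `hCk` — **K-STOREY BRICK (K2b-δ₃)-C (px12 g17, LOCATE-K137 529f36ee road
# (K2)): THE ONE-FORM CONJUGATED RESOLVENT IS CLOSE TO THE RESOLVENT, AT THE MEMBER** — the `hB` letter (`δ₃`) of ✓p767718 `Prop7KinvConjugateDecay.conj_accretive_of_letters` for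
# `G = G_T(U₀) = Δ_a(U₀)⁻¹` on the class `PosOnto`: for a positive site weight `w` with both bond ratios `≤ ρ`, hypothesis-described fine multipliers `M_f ↔ w(b₋)`, `M_fi ↔ w(b₋)⁻¹`, and the
# DISPLAYED FORM LETTERS (γ) `hco`, (C_V) `hVlow`, (θ_V) `hVconj` — A3 ✓`Prop7OneFormAgmon.agmon_oneForm_of_letters`' three letters VERBATIM — plus the BILINEAR letter (θ₂) `hVconj₂`
# (FILE B2 ✓∕⧗`Prop7OneFormAgmonBilinearExport.hVconj₂_of_letters`' text): **`∀ x, ‖M_f(G_T(M_fi x)) − G_T x‖ ≤ δ₃·‖x‖`**, `δ₃ = γ^{−1∕2}·(δ₁√(1+C_V∕γ)Θ⁻¹ + δ₁γ^{−1∕2}b₁ + (δ₁² + θ₂)γ^{−1∕2}Θ⁻¹)`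
# with any displayed `d₁ ≥ δ₁ = √(3η⁻²ρ²)` (px5 g11 ✓`normSq_gradDefect_le`), `Θ = (1−ε)γ − εC_V − d₁²(1+1∕ε) − θ_V > 0`, `b₁ = √((Θ⁻¹ + c₁Θ⁻²)∕(1−ε))`, `c₁ = d₁²(1+1∕ε) + C_V + θ_V` — A3's plumbing
# (Kato gradient ✓`exists_katoGradient`, componentwise weights `M′`, gradient defects `K₁ = M′_i∘D∘M − D`, `K₁′`) feeding (K2b-δ₃)-A ✓∕⧗`Prop7OneFormConjugateResolvent.norm_conj_resolvent_sub_le`.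

Cell `ym3-torus` (HUMAN RULING D-0037: SU(2) YM₃ on T³ is ladder rung R3 — NOT d = 4, NOT infinite volume, NOT a mass gap, NOT Clay).  Width seat `ym3-torus-px12` gen 17.  THEOREMS ONLY
(0 `def`, 0 `sorry`); `--supports stmt-QuantumFields-19200 --as helper`, count-neutral.  HONEST LABEL: A3's instantiation re-run with two more letters; CONDITIONAL on (γ)(C_V)(θ_V)(θ₂) and `PosOnto`
(discharged at `DeltaEtaSlot` under `RegPr` + Lift by ✓p767766 `hco_DeltaEtaSlot_exists`, px21 ✓p768234 `hVlow_abs_of_lift`, A2g ✓`hVconj_phaseClass_of_letters`, FILE B2); with the block-distance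
exponential weights (`ρ = e^{rη} − 1`, `3η⁻²ρ² ≤ 3r²e^{2r}`) every constant is K-FREE at the pins; nothing of (3.46)∕(3.132), `h137kπ`, `h137kΔ`, `hCk`, EX or 19200 is proved here.

WHAT IS PROVED (ns `Summit.QuantumFields.YangMills.Theorems.Prop7OneFormConjugateResolventOfLetters`; member `F`, `h : n ≤ K`, weights `c₀ cB`, slot `Δx`, coupling `a`).
* ★★★ `conj_resolvent_oneForm_of_letters` — THE THEOREM ABOVE (`U₀` on `PosOnto`, any slot, any coupling).
HYP-SAT (★★OWNER RULING №42): (γ)(C_V)(θ_V) exactly A3's (inhabited as listed); (θ₂) = FILE B2's conclusion text; the multiplier rows are inhabited by A3 ✓`exists_smulBond`; `PosOnto` by ✓p767766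
`posOnto_of_coercive`; nothing eventual; no hypothesis restates the conclusion (operator closeness vs form letters).

References: T. Bałaban, CMP **99** (1985) 389–434 [Balaban1985BackgroundPropagators] ((3.26)–(3.27) p.395, Thm 3.1 (3.46) p.398, (3.132) p.422); CMP **102** (1985) 277–309 [Balaban1985Variational]
((134)–(136) p.298); S. Agmon, *Lectures on exponential decay* (Princeton 1982) Ch. 1 [Agmon1982].
-/

set_option autoImplicit false

noncomputable section

open scoped Matrix.Norms.L2Operator BigOperators InnerProductSpace ComplexConjugate

namespace Summit.QuantumFields.YangMills.Theorems.Prop7OneFormConjugateResolventOfLetters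

open Literature.MathematicalPhysics.QuantumFieldTheory.Balaban1983to89
open Literature.MathematicalPhysics.QuantumFieldTheory.Balaban1983to89.T3ContinuumYM3Torus
open T3SectALandauChart (formComp bgUnits eta eta_pos)
open B9Eq39Adjoint (R)
open B11Eq103H1Complex (SiteL2K BondL2K)
open Summit.QuantumFields.YangMills.Theorems.Prop7SectET3Transport (periodsT3)
open Summit.QuantumFields.YangMills.Theorems.Prop7SectET3HilbertLetters (W₂ toL2 toL2S DL2 inner_toL2)
open Summit.QuantumFields.YangMills.Theorems.Prop7SectET3CurvedPropagators (laplaceA GT PosOnto laplaceA_GT)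
open Summit.QuantumFields.YangMills.Theorems.Prop7MassivePropagatorAgmonLetters (inner_toL2_smul_left inner_toL2_smul_smul_inv DL2_smul_eq_smul_add_defect normSq_gradDefect_le)
open Summit.QuantumFields.YangMills.Theorems.Prop7OneFormAgmon (exists_katoGradient norm_sq_toL2_eq_sum_formComp)
open Summit.QuantumFields.YangMills.Theorems.Prop7OneFormConjugateResolvent (norm_conj_resolvent_sub_le)

variable {F : T3Family} {n K : ℕ} {c₀ : ℝ} [Fact (0 < c₀)] {h : n ≤ K} {cB a : ℝ} [Fact (0 < cB)]
  {Δx : GaugeField (F.P K) 0 (Matrix.specialUnitaryGroup (Fin 2) ℂ) → (BondL2K ℂ 3 (periodsT3 F K) c₀ W₂ →ₗ[ℂ] BondL2K ℂ 3 (periodsT3 F K) c₀ W₂)}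

set_option maxHeartbeats 400000 in
-- hb: A3 ✓`agmon_oneForm_of_letters`' plumbing (Kato gradient, componentwise weights, two defect bounds) re-run plus the two extra letter translations; same budget class as A3.
/-- ★★★ **THE ONE-FORM CONJUGATED RESOLVENT IS CLOSE TO THE RESOLVENT, FROM THE LETTERS.**  `U₀` on the class `PosOnto` (so `Δ_aG_T = 1`), any slot `Δx`, any coupling `a`; a positive site
weight `w` with `|w(b₊)∕w(b₋) − 1|, |w(b₋)∕w(b₊) − 1| ≤ ρ`; linear maps `M_f ↔ w(b₋)`, `M_fi ↔ w(b₋)⁻¹` on the fine carrier (rows `hMf`, `hMfi`); the form letters (γ) `hco` (`0 < γ`), (C_V) `hVlow`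
(`0 ≤ C_V`), (θ_V) `hVconj` (`0 ≤ θ_V`) — A3's texts — and the bilinear (θ₂) `hVconj₂` (`0 ≤ θ₂`, FILE B2's text); a majorant `3η⁻²ρ² ≤ d₁²`; `0 < ε < 1` with `Θ := (1−ε)γ − εC_V − d₁²(1+1∕ε) − θ_V > 0`.  THEN
**`∀ x, ‖M_f(G_T(M_fi x)) − G_T x‖ ≤ γ^{−1∕2}·(d₁·√(1+C_V∕γ)·Θ⁻¹ + d₁·γ^{−1∕2}·√((Θ⁻¹ + c₁Θ⁻²)∕(1−ε)) + (d₁² + θ₂)·γ^{−1∕2}·Θ⁻¹)·‖x‖`** for ANY displayed majorant `d₁ ≥ 0` of the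
gradient defect, `3η⁻²ρ² ≤ d₁²` (`d₁ := √3·r·e^{r}` for the phase class), `Θ = (1−ε)γ − εC_V − d₁²(1+1∕ε) − θ_V`, `c₁ = d₁²(1+1∕ε) + C_V + θ_V` — the `hB` letter of ✓`conj_accretive_of_letters`. [cite: Balaban1985BackgroundPropagators, (3.26) p.395, Thm 3.1 (3.46) p.398, (3.132) p.422; Balaban1985Variational, (134)–(136) p.298; Agmon1982, Ch. 1] -/
theorem conj_resolvent_oneForm_of_letters (U₀ : GaugeField (F.P K) 0 (Matrix.specialUnitaryGroup (Fin 2) ℂ)) (hp : PosOnto F n K h c₀ cB a Δx U₀)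
    (w : Site (F.P K) 0 → ℝ) (hw : ∀ x, 0 < w x) {ρ : ℝ}
    (hρ : ∀ b : PBond (F.P K) 0, |w b.tgt / w b.src - 1| ≤ ρ) (hρ' : ∀ b : PBond (F.P K) 0, |w b.src / w b.tgt - 1| ≤ ρ)
    (Mf Mfi : BondL2K ℂ 3 (periodsT3 F K) c₀ W₂ →ₗ[ℂ] BondL2K ℂ 3 (periodsT3 F K) c₀ W₂)
    (hMf : ∀ X : PBond (F.P K) 0 → Matrix (Fin 2) (Fin 2) ℂ, Mf (toL2 F K c₀ X) = toL2 F K c₀ (fun b => w b.src • X b))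
    (hMfi : ∀ X : PBond (F.P K) 0 → Matrix (Fin 2) (Fin 2) ℂ, Mfi (toL2 F K c₀ X) = toL2 F K c₀ (fun b => (w b.src)⁻¹ • X b))
    {d₁ : ℝ} (hd₁0 : 0 ≤ d₁) (hd₁ : 3 * ((eta F n K)⁻¹) ^ 2 * ρ ^ 2 ≤ d₁ ^ 2)
    {γ CV θV θ₂ ε : ℝ} (hγ : 0 < γ) (hCV : 0 ≤ CV) (hθV : 0 ≤ θV) (hθ₂ : 0 ≤ θ₂) (hε : 0 < ε) (hε1 : ε < 1)
    (hΘ : 0 < (1 - ε) * γ - ε * CV - d₁ ^ 2 * (1 + 1 / ε) - θV)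
    (hco : ∀ v : BondL2K ℂ 3 (periodsT3 F K) c₀ W₂, γ * ‖v‖ ^ 2 ≤ RCLike.re ⟪v, laplaceA F n K h c₀ cB a Δx U₀ v⟫_ℂ)
    (hVlow : ∀ X : PBond (F.P K) 0 → Matrix (Fin 2) (Fin 2) ℂ,
      -(CV * ‖toL2 F K c₀ X‖ ^ 2) ≤ RCLike.re ⟪toL2 F K c₀ X, laplaceA F n K h c₀ cB a Δx U₀ (toL2 F K c₀ X)⟫_ℂ
        - ∑ μ : Fin (F.P K).d, ‖DL2 F n K c₀ U₀ (toL2S F K c₀ (formComp X μ))‖ ^ 2)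
    (hVconj : ∀ X : PBond (F.P K) 0 → Matrix (Fin 2) (Fin 2) ℂ,
      RCLike.re ⟪toL2 F K c₀ X, laplaceA F n K h c₀ cB a Δx U₀ (toL2 F K c₀ X)⟫_ℂ
          - (∑ μ : Fin (F.P K).d, ‖DL2 F n K c₀ U₀ (toL2S F K c₀ (formComp X μ))‖ ^ 2) - θV * ‖toL2 F K c₀ X‖ ^ 2
        ≤ RCLike.re ⟪toL2 F K c₀ (fun b => w b.src • X b), laplaceA F n K h c₀ cB a Δx U₀ (toL2 F K c₀ (fun b => (w b.src)⁻¹ • X b))⟫_ℂ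
          - RCLike.re (∑ μ : Fin (F.P K).d, ⟪DL2 F n K c₀ U₀ (toL2S F K c₀ (formComp (fun b => w b.src • X b) μ)),
              DL2 F n K c₀ U₀ (toL2S F K c₀ (formComp (fun b => (w b.src)⁻¹ • X b) μ))⟫_ℂ))
    (hVconj₂ : ∀ X' X'' : PBond (F.P K) 0 → Matrix (Fin 2) (Fin 2) ℂ,
      |RCLike.re ((⟪toL2 F K c₀ (fun b => w b.src • X' b), laplaceA F n K h c₀ cB a Δx U₀ (toL2 F K c₀ (fun b => (w b.src)⁻¹ • X'' b))⟫_ℂ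
            - ∑ μ : Fin (F.P K).d, ⟪DL2 F n K c₀ U₀ (toL2S F K c₀ (formComp (fun b => w b.src • X' b) μ)),
                DL2 F n K c₀ U₀ (toL2S F K c₀ (formComp (fun b => (w b.src)⁻¹ • X'' b) μ))⟫_ℂ)
          - (⟪toL2 F K c₀ X', laplaceA F n K h c₀ cB a Δx U₀ (toL2 F K c₀ X'')⟫_ℂ
            - ∑ μ : Fin (F.P K).d, ⟪DL2 F n K c₀ U₀ (toL2S F K c₀ (formComp X' μ)), DL2 F n K c₀ U₀ (toL2S F K c₀ (formComp X'' μ))⟫_ℂ))|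
        ≤ θ₂ * ‖toL2 F K c₀ X'‖ * ‖toL2 F K c₀ X''‖)
    (x : BondL2K ℂ 3 (periodsT3 F K) c₀ W₂) :
    ‖Mf (GT F n K h c₀ cB a Δx U₀ (Mfi x)) - GT F n K h c₀ cB a Δx U₀ x‖
      ≤ (Real.sqrt γ)⁻¹ * (d₁ * Real.sqrt (1 + CV / γ) * ((1 - ε) * γ - ε * CV - d₁ ^ 2 * (1 + 1 / ε) - θV)⁻¹
          + d₁ * (Real.sqrt γ)⁻¹ * Real.sqrt ((((1 - ε) * γ - ε * CV - d₁ ^ 2 * (1 + 1 / ε) - θV)⁻¹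
              + (d₁ ^ 2 * (1 + 1 / ε) + CV + θV) * ((1 - ε) * γ - ε * CV - d₁ ^ 2 * (1 + 1 / ε) - θV)⁻¹ ^ 2) / (1 - ε))
          + (d₁ ^ 2 + θ₂) * (Real.sqrt γ)⁻¹ * ((1 - ε) * γ - ε * CV - d₁ ^ 2 * (1 + 1 / ε) - θV)⁻¹) * ‖x‖ := by
  have hw0 : ∀ x, w x ≠ 0 := fun x => (hw x).ne'
  have hwi0 : ∀ x, (w x)⁻¹ ≠ 0 := fun x => inv_ne_zero (hw0 x)
  have hρ'' : ∀ b : PBond (F.P K) 0, |(w b.tgt)⁻¹ / (w b.src)⁻¹ - 1| ≤ ρ := fun b => by rw [inv_div_inv]; exact hρ' b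
  have surj : ∀ v : BondL2K ℂ 3 (periodsT3 F K) c₀ W₂, ∃ X, v = toL2 F K c₀ X := fun v => ⟨(toL2 F K c₀).symm v, ((toL2 F K c₀).apply_symm_apply v).symm⟩
  -- the Kato gradient and its adjoint
  obtain ⟨D, hDcomp, hDnorm, hDinner⟩ := exists_katoGradient (c₀ := c₀) (n := n) U₀
  set Dad := LinearMap.adjoint D with hDad_def
  have hDad : ∀ (v : BondL2K ℂ 3 (periodsT3 F K) c₀ W₂) (g : PiLp 2 (fun _ : Fin (F.P K).d => BondL2K ℂ 3 (periodsT3 F K) c₀ W₂)), ⟪D v, g⟫_ℂ = ⟪v, Dad g⟫_ℂ :=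
    fun v g => (LinearMap.adjoint_inner_right D v g).symm
  -- `T = Δ_a`, `V = Δ_a − D†D`, `G = G_T`
  set T := laplaceA F n K h c₀ cB a Δx U₀ with hT_def
  set V : BondL2K ℂ 3 (periodsT3 F K) c₀ W₂ →ₗ[ℂ] BondL2K ℂ 3 (periodsT3 F K) c₀ W₂ := T - Dad ∘ₗ D with hV_def
  have hT : ∀ v, T v = Dad (D v) + V v := fun v => by
    rw [hV_def, LinearMap.sub_apply, LinearMap.comp_apply, add_sub_cancel]
  have hTG : ∀ f, T (GT F n K h c₀ cB a Δx U₀ f) = f := fun f => laplaceA_GT hp f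
  have hVform₂ : ∀ X' X'' : PBond (F.P K) 0 → Matrix (Fin 2) (Fin 2) ℂ, ⟪toL2 F K c₀ X', V (toL2 F K c₀ X'')⟫_ℂ
      = ⟪toL2 F K c₀ X', T (toL2 F K c₀ X'')⟫_ℂ
        - ∑ μ : Fin (F.P K).d, ⟪DL2 F n K c₀ U₀ (toL2S F K c₀ (formComp X' μ)), DL2 F n K c₀ U₀ (toL2S F K c₀ (formComp X'' μ))⟫_ℂ := by
    intro X' X''
    rw [hV_def, LinearMap.sub_apply, LinearMap.comp_apply, inner_sub_right, ← hDad, hDinner]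
  have hVform : ∀ X : PBond (F.P K) 0 → Matrix (Fin 2) (Fin 2) ℂ, RCLike.re ⟪toL2 F K c₀ X, V (toL2 F K c₀ X)⟫_ℂ
      = RCLike.re ⟪toL2 F K c₀ X, T (toL2 F K c₀ X)⟫_ℂ - ∑ μ : Fin (F.P K).d, ‖DL2 F n K c₀ U₀ (toL2S F K c₀ (formComp X μ))‖ ^ 2 := by
    intro X
    rw [hV_def, LinearMap.sub_apply, LinearMap.comp_apply, inner_sub_right, map_sub, ← hDad, inner_self_eq_norm_sq, hDnorm]
  -- the multipliers on `E` are the given ones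
  have hMiM : ∀ v, Mfi (Mf v) = v := fun v => by
    obtain ⟨X, rfl⟩ := surj v
    rw [hMf, hMfi]; congr 1; funext b; rw [smul_smul, inv_mul_cancel₀ (hw0 _), one_smul]
  have hMMi : ∀ v, Mf (Mfi v) = v := fun v => by
    obtain ⟨X, rfl⟩ := surj v
    rw [hMfi, hMf]; congr 1; funext b; rw [smul_smul, mul_inv_cancel₀ (hw0 _), one_smul]
  have hMsa : ∀ x y : BondL2K ℂ 3 (periodsT3 F K) c₀ W₂, ⟪Mf x, y⟫_ℂ = ⟪x, Mf y⟫_ℂ := fun x y => by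
    obtain ⟨X, rfl⟩ := surj x
    obtain ⟨Y, rfl⟩ := surj y
    rw [hMf, hMf]
    exact inner_toL2_smul_left F _ X Y
  -- the multipliers on `G`, componentwise
  set Φ := WithLp.linearEquiv 2 ℂ (Fin (F.P K).d → BondL2K ℂ 3 (periodsT3 F K) c₀ W₂) with hΦ
  set M' : PiLp 2 (fun _ : Fin (F.P K).d => BondL2K ℂ 3 (periodsT3 F K) c₀ W₂) →ₗ[ℂ] PiLp 2 (fun _ : Fin (F.P K).d => BondL2K ℂ 3 (periodsT3 F K) c₀ W₂) :=
    Φ.symm.toLinearMap ∘ₗ (LinearMap.pi fun μ : Fin (F.P K).d => Mf ∘ₗ LinearMap.proj μ) ∘ₗ Φ.toLinearMap with hM'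
  set M'i : PiLp 2 (fun _ : Fin (F.P K).d => BondL2K ℂ 3 (periodsT3 F K) c₀ W₂) →ₗ[ℂ] PiLp 2 (fun _ : Fin (F.P K).d => BondL2K ℂ 3 (periodsT3 F K) c₀ W₂) :=
    Φ.symm.toLinearMap ∘ₗ (LinearMap.pi fun μ : Fin (F.P K).d => Mfi ∘ₗ LinearMap.proj μ) ∘ₗ Φ.toLinearMap with hM'i
  have hM'_of : ∀ z μ, WithLp.ofLp (M' z) μ = Mf (WithLp.ofLp z μ) := fun z μ => by
    simp only [hM', LinearMap.comp_apply, LinearEquiv.coe_toLinearMap, hΦ, WithLp.coe_symm_linearEquiv, WithLp.coe_linearEquiv, WithLp.ofLp_toLp,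
      LinearMap.pi_apply, LinearMap.proj_apply]
  have hM'i_of : ∀ z μ, WithLp.ofLp (M'i z) μ = Mfi (WithLp.ofLp z μ) := fun z μ => by
    simp only [hM'i, LinearMap.comp_apply, LinearEquiv.coe_toLinearMap, hΦ, WithLp.coe_symm_linearEquiv, WithLp.coe_linearEquiv, WithLp.ofLp_toLp,
      LinearMap.pi_apply, LinearMap.proj_apply]
  have ofLp_inj : ∀ x y : PiLp 2 (fun _ : Fin (F.P K).d => BondL2K ℂ 3 (periodsT3 F K) c₀ W₂), WithLp.ofLp x = WithLp.ofLp y → x = y :=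
    fun x y hxy => by rw [← WithLp.toLp_ofLp (p := 2) x, hxy, WithLp.toLp_ofLp]
  have hM'M'i : ∀ z, M' (M'i z) = z := fun z => ofLp_inj _ _ (funext fun μ => by rw [hM'_of, hM'i_of, hMMi])
  have hM'iM' : ∀ z, M'i (M' z) = z := fun z => ofLp_inj _ _ (funext fun μ => by rw [hM'i_of, hM'_of, hMiM])
  have hinnerP : ∀ x y : PiLp 2 (fun _ : Fin (F.P K).d => BondL2K ℂ 3 (periodsT3 F K) c₀ W₂),
      ⟪x, y⟫_ℂ = ∑ μ : Fin (F.P K).d, ⟪WithLp.ofLp x μ, WithLp.ofLp y μ⟫_ℂ := fun x y => PiLp.inner_apply x y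
  have hpair : ∀ x y, ⟪M' x, M'i y⟫_ℂ = ⟪x, y⟫_ℂ := fun x y => by
    rw [hinnerP, hinnerP x y]
    refine Finset.sum_congr rfl fun μ _ => ?_
    rw [hM'_of, hM'i_of]
    obtain ⟨X, hX⟩ := surj (WithLp.ofLp x μ)
    obtain ⟨Y, hY⟩ := surj (WithLp.ofLp y μ)
    rw [hX, hY, hMf, hMfi]
    exact inner_toL2_smul_smul_inv F (fun b : PBond (F.P K) 0 => w b.src) (fun b => hw0 b.src) X Y
  -- the gradient defects
  set K₁ : BondL2K ℂ 3 (periodsT3 F K) c₀ W₂ →ₗ[ℂ] PiLp 2 (fun _ : Fin (F.P K).d => BondL2K ℂ 3 (periodsT3 F K) c₀ W₂) := M'i ∘ₗ D ∘ₗ Mf - D with hK₁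
  set K₁' : BondL2K ℂ 3 (periodsT3 F K) c₀ W₂ →ₗ[ℂ] PiLp 2 (fun _ : Fin (F.P K).d => BondL2K ℂ 3 (periodsT3 F K) c₀ W₂) := M' ∘ₗ D ∘ₗ Mfi - D with hK₁'
  have hK₁v : ∀ v, K₁ v = M'i (D (Mf v)) - D v := fun v => rfl
  have hK₁'v : ∀ v, K₁' v = M' (D (Mfi v)) - D v := fun v => rfl
  have hK₁eq : ∀ v, D (Mf v) = M' (D v + K₁ v) := fun v => by
    rw [hK₁v, add_sub_cancel, hM'M'i]
  have hK₁'eq : ∀ v, D (Mfi v) = M'i (D v + K₁' v) := fun v => by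
    rw [hK₁'v, add_sub_cancel, hM'iM']
  have hdef : ∀ (ω : Site (F.P K) 0 → ℝ) (hω : ∀ x, ω x ≠ 0) (Mω Mωi : BondL2K ℂ 3 (periodsT3 F K) c₀ W₂ →ₗ[ℂ] BondL2K ℂ 3 (periodsT3 F K) c₀ W₂)
      (hMω : ∀ X : PBond (F.P K) 0 → Matrix (Fin 2) (Fin 2) ℂ, Mω (toL2 F K c₀ X) = toL2 F K c₀ (fun b => ω b.src • X b))
      (hMωi : ∀ X : PBond (F.P K) 0 → Matrix (Fin 2) (Fin 2) ℂ, Mωi (toL2 F K c₀ X) = toL2 F K c₀ (fun b => (ω b.src)⁻¹ • X b))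
      (X : PBond (F.P K) 0 → Matrix (Fin 2) (Fin 2) ℂ) (μ : Fin (F.P K).d),
      Mωi (WithLp.ofLp (D (Mω (toL2 F K c₀ X))) μ) - WithLp.ofLp (D (toL2 F K c₀ X)) μ
        = toL2 F K c₀ (fun b => ((eta F n K)⁻¹ * (ω b.tgt / ω b.src - 1)) • R (bgUnits F K U₀ b) (formComp X μ b.tgt)) := by
    intro ω hω Mω Mωi hMω hMωi X μ
    rw [hMω, hDcomp, hDcomp]
    have hread : DL2 F n K c₀ U₀ (toL2S F K c₀ (formComp (fun b => ω b.src • X b) μ))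
        = toL2 F K c₀ ((toL2 F K c₀).symm (DL2 F n K c₀ U₀ (toL2S F K c₀ (fun x => ω x • formComp X μ x)))) := by
      rw [LinearEquiv.apply_symm_apply]; rfl
    have hread' : DL2 F n K c₀ U₀ (toL2S F K c₀ (formComp X μ)) = toL2 F K c₀ ((toL2 F K c₀).symm (DL2 F n K c₀ U₀ (toL2S F K c₀ (formComp X μ)))) := by
      rw [LinearEquiv.apply_symm_apply]
    rw [hread, hMωi, hread', ← map_sub]
    congr 1
    funext b
    rw [Pi.sub_apply, DL2_smul_eq_smul_add_defect F U₀ ω (formComp X μ) b (hω _), smul_smul, inv_mul_cancel₀ (hω _), one_smul, add_sub_cancel_left]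
  have hδ₁sq : 0 ≤ 3 * ((eta F n K)⁻¹) ^ 2 * ρ ^ 2 := by positivity
  set δ₁ := Real.sqrt (3 * ((eta F n K)⁻¹) ^ 2 * ρ ^ 2) with hδ₁
  have hδ₁0 : 0 ≤ δ₁ := Real.sqrt_nonneg _
  have hδ₁2 : δ₁ ^ 2 = 3 * ((eta F n K)⁻¹) ^ 2 * ρ ^ 2 := Real.sq_sqrt hδ₁sq
  have hbound : ∀ (ω : Site (F.P K) 0 → ℝ) (hω : ∀ x, ω x ≠ 0) (hωρ : ∀ b : PBond (F.P K) 0, |ω b.tgt / ω b.src - 1| ≤ ρ)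
      (Mω Mωi : BondL2K ℂ 3 (periodsT3 F K) c₀ W₂ →ₗ[ℂ] BondL2K ℂ 3 (periodsT3 F K) c₀ W₂)
      (hMω : ∀ X : PBond (F.P K) 0 → Matrix (Fin 2) (Fin 2) ℂ, Mω (toL2 F K c₀ X) = toL2 F K c₀ (fun b => ω b.src • X b))
      (hMωi : ∀ X : PBond (F.P K) 0 → Matrix (Fin 2) (Fin 2) ℂ, Mωi (toL2 F K c₀ X) = toL2 F K c₀ (fun b => (ω b.src)⁻¹ • X b))
      (N : PiLp 2 (fun _ : Fin (F.P K).d => BondL2K ℂ 3 (periodsT3 F K) c₀ W₂) →ₗ[ℂ] PiLp 2 (fun _ : Fin (F.P K).d => BondL2K ℂ 3 (periodsT3 F K) c₀ W₂))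
      (hN : ∀ z μ, WithLp.ofLp (N z) μ = Mωi (WithLp.ofLp z μ))
      (v : BondL2K ℂ 3 (periodsT3 F K) c₀ W₂), ‖(N ∘ₗ D ∘ₗ Mω - D) v‖ ≤ δ₁ * ‖v‖ := by
    intro ω hω hωρ Mω Mωi hMω hMωi N hN v
    obtain ⟨X, rfl⟩ := surj v
    have hsq : ‖(N ∘ₗ D ∘ₗ Mω - D) (toL2 F K c₀ X)‖ ^ 2 ≤ (δ₁ * ‖toL2 F K c₀ X‖) ^ 2 := by
      rw [PiLp.norm_sq_eq_of_L2, mul_pow, hδ₁2, norm_sq_toL2_eq_sum_formComp, Finset.mul_sum]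
      refine Finset.sum_le_sum fun μ _ => ?_
      have hcompμ : WithLp.ofLp ((N ∘ₗ D ∘ₗ Mω - D) (toL2 F K c₀ X)) μ
          = toL2 F K c₀ (fun b => ((eta F n K)⁻¹ * (ω b.tgt / ω b.src - 1)) • R (bgUnits F K U₀ b) (formComp X μ b.tgt)) := by
        have e : (N ∘ₗ D ∘ₗ Mω - D) (toL2 F K c₀ X) = N (D (Mω (toL2 F K c₀ X))) - D (toL2 F K c₀ X) := rfl
        rw [e, WithLp.ofLp_sub, Pi.sub_apply, hN]
        exact hdef ω hω Mω Mωi hMω hMωi X μ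
      rw [hcompμ]
      exact normSq_gradDefect_le F U₀ ω hωρ (formComp X μ)
    have h0 : 0 ≤ δ₁ * ‖toL2 F K c₀ X‖ := by positivity
    exact (pow_le_pow_iff_left₀ (norm_nonneg _) h0 two_ne_zero).mp hsq
  have bK₁ : ∀ v, ‖K₁ v‖ ≤ δ₁ * ‖v‖ := fun v =>
    hbound w hw0 hρ Mf Mfi hMf hMfi M'i hM'i_of v
  have bK₁' : ∀ v, ‖K₁' v‖ ≤ δ₁ * ‖v‖ := fun v => by
    have hMi' : ∀ X : PBond (F.P K) 0 → Matrix (Fin 2) (Fin 2) ℂ, Mfi (toL2 F K c₀ X) = toL2 F K c₀ (fun b => (fun x => (w x)⁻¹) b.src • X b) := hMfi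
    have hM'' : ∀ X : PBond (F.P K) 0 → Matrix (Fin 2) (Fin 2) ℂ, Mf (toL2 F K c₀ X) = toL2 F K c₀ (fun b => ((fun x => (w x)⁻¹) b.src)⁻¹ • X b) := fun X => by
      rw [hMf]; congr 1; funext b; rw [inv_inv]
    exact hbound (fun x => (w x)⁻¹) hwi0 hρ'' Mfi Mf hMi' hM'' M' hM'_of v
  -- the four form letters in the engine's currency
  have hco' : ∀ v, γ * ‖v‖ ^ 2 ≤ RCLike.re ⟪v, T v⟫_ℂ := hco
  have hVlow' : ∀ v, -(CV * ‖v‖ ^ 2) ≤ RCLike.re ⟪v, V v⟫_ℂ := fun v => by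
    obtain ⟨X, rfl⟩ := surj v
    rw [hVform]
    exact hVlow X
  have hVconj' : ∀ v, RCLike.re ⟪v, V v⟫_ℂ - θV * ‖v‖ ^ 2 ≤ RCLike.re ⟪Mf v, V (Mfi v)⟫_ℂ := fun v => by
    obtain ⟨X, rfl⟩ := surj v
    rw [hVform, hV_def, LinearMap.sub_apply, LinearMap.comp_apply, inner_sub_right, map_sub, ← hDad, hMf, hMfi, hDinner]
    exact hVconj X
  have hVconj₂' : ∀ x y, |RCLike.re (⟪Mf x, V (Mfi y)⟫_ℂ - ⟪x, V y⟫_ℂ)| ≤ θ₂ * ‖x‖ * ‖y‖ := fun x y => by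
    obtain ⟨X', rfl⟩ := surj x
    obtain ⟨X'', rfl⟩ := surj y
    rw [hMf, hMfi, hVform₂, hVform₂]
    exact hVconj₂ X' X''
  -- the defect bound `δ₁ ≤ d₁`
  have hδd : δ₁ ≤ d₁ := by
    rw [hδ₁, ← Real.sqrt_sq hd₁0]; exact Real.sqrt_le_sqrt hd₁
  have bK₁d : ∀ v, ‖K₁ v‖ ≤ d₁ * ‖v‖ := fun v => (bK₁ v).trans (mul_le_mul_of_nonneg_right hδd (norm_nonneg _))
  have bK₁'d : ∀ v, ‖K₁' v‖ ≤ d₁ * ‖v‖ := fun v => (bK₁' v).trans (mul_le_mul_of_nonneg_right hδd (norm_nonneg _))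
  -- the engine
  exact norm_conj_resolvent_sub_le D Dad hDad T V hT Mf Mfi M' M'i hMiM hMMi hMsa hpair K₁ K₁' hK₁eq hK₁'eq hγ hCV hd₁0 hθV hθ₂ hε hε1 hΘ
    hco' hVlow' bK₁d bK₁'d hVconj' hVconj₂' (GT F n K h c₀ cB a Δx U₀) hTG x

end Summit.QuantumFields.YangMills.Theorems.Prop7OneFormConjugateResolventOfLetters

end
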